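import Literature.Analysis.FunctionSpaces.SobolevDifferenceQuotients
import Literature.MathematicalPhysics.QuantumFieldTheory.Balaban1983to89.B4Eq19LatticeOperators
import HarnessLib

/-!
# Crux `HistoryTailL` (stmt-QuantumFields-19936) ∕ K2 crux `BlockLipschitzL` (stmt-QuantumFields-23533), LINE 25 «CompactnessTransfer» v1.4 —
# FILE (Γ2-IBP)-letters «THE LETTERS OF THE BLOW-DOWN WEAK-GRADIENT IDENTITY»

Cell `ym3-torus` (YM ladder rung R3 = continuum SU(2) Yang–Mills on T³ — a RUNG, NOT the Clay problem: not d = 4, not infinite volume, not a mass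
gap); LEAD seat `ym-ust-19936-w1` g10.  Helper `--supports stmt-QuantumFields-19936`; THEOREMS ONLY (0 `def`, 0 `sorry`, default heartbeats).

WHY.  LINE 25 v1.4 states the continuum fact S1″ and the lattice stub S2♭″ in the tree's Sobolev vocabulary (lit `SobolevDomain.HasWeakFDerivOn`).
The bridge from Γ1's output (✓p718508 `stub_blowDownL2Compact`: `L²`-limit `U` of the piecewise-constant blow-downs + convergent dyadic means of the
rescaled forward differences) and ★w8's (Γ2-W) weak limit `G_μ` to `HasWeakFDerivOn ⟨Q,hQ⟩ volume U G` is the discrete integration-by-parts identity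
of the companion file `PoincareLipschitzBlowDownWeakGradient`.  This file holds its letters: bounded measurable
maps are integrable on finite measures; the EXACT lattice shift identity `⌊R(x + e_μ∕R)⌋ = ⌊Rx⌋ + e_μ`; and the Hölder-free passage `L²(Q) → L¹(Q)`
for uniformly bounded sequences; plus the two evaluation rows of the bundled gradient `v ↦ Σ_μ v_μ • G_μ x` (S1″'s density letter
`Σ_i ‖G x (single i 1)‖² = Σ_i ‖G_i x‖²`).

WHAT IS PROVED (ns `…Theorems.PoincareLipschitzBlowDownWeakGradientLetters`): `integrable_of_norm_le`,
★`floorVec_add_inv_smul_single`, ★`tendsto_setIntegral_norm_of_sq`, `sum_smulRight_apply_single`, `sum_smulRight_apply`.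
HONEST SCOPE.  Measure∕lattice letters; nothing of S1″, S2♭″, `hHalvingBand`, K1, `MeanDeviationL`, `BlockLipschitzL` or `HistoryTailL` is proved here.
YM₃ on T³ is rung R3, not Clay; YM gap NOT proved; no summit statement is proved here.

References: L. C. Evans, Partial Differential Equations (2010) §5.8.2 [Evans2010]; R. Alicandro, M. Cicalese, SIAM J. Math. Anal. 2008 (lattice-to-continuum
for `S^k` spin energies) [AlicandroCicalese2008].
-/

set_option autoImplicit false

noncomputable section

open scoped BigOperators ENNReal Topology
open MeasureTheory Set Filter

namespace Summit.QuantumFields.YangMills.Theorems.PoincareLipschitzBlowDownWeakGradientLetters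

open Literature.MathematicalPhysics.QuantumFieldTheory.Balaban1983to89
open B4Eq19LatticeOperators (Zd box unitVec)

/-! ## §1 Letters: bounded measurable maps are integrable on finite measures; the lattice shift identity; `L² → L¹` -/

/-- A bounded a.e.-strongly measurable function is integrable for a finite measure. [folklore] -/
theorem integrable_of_norm_le {α F : Type*} [MeasurableSpace α] {ν : Measure α} [IsFiniteMeasure ν]
    [NormedAddCommGroup F] {f : α → F} (hf : AEStronglyMeasurable f ν) (C : ℝ) (h : ∀ᵐ x ∂ν, ‖f x‖ ≤ C) :
    Integrable f ν :=
  memLp_one_iff_integrable.1 (MemLp.of_bound hf C h)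

/-- The lattice shift identity behind the rescaled forward difference: moving `x` by `R⁻¹ eμ` moves the floor vector `⌊R x⌋` by the unit
vector `e_μ`, exactly. [folklore] -/
theorem floorVec_add_inv_smul_single {R : ℝ} (hR : R ≠ 0) (x : EuclideanSpace ℝ (Fin 3)) (μ : Fin 3) :
    (fun i => ⌊R * (x + R⁻¹ • EuclideanSpace.single μ (1:ℝ)) i⌋ : Zd 3) = (fun i => ⌊R * x i⌋) + unitVec μ := by
  funext i
  simp only [PiLp.add_apply, PiLp.smul_apply, PiLp.single_apply, smul_eq_mul, Pi.add_apply, unitVec,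
    Pi.single_apply]
  by_cases h : i = μ
  · simp only [h, if_true, mul_one, mul_add, mul_inv_cancel₀ hR]
    exact Int.floor_add_one _
  · simp only [h, if_false, mul_zero, add_zero]

/-- From `L²` to `L¹` on a set of finite volume without Hölder: if `∫_S ‖d k‖² → 0` for uniformly bounded measurable `d k`, then
`∫_S ‖d k‖ → 0` (pointwise `‖d‖ ≤ η∕2 + ‖d‖²∕(2η)` for every `η > 0`). [folklore] -/
theorem tendsto_setIntegral_norm_of_sq {d : ℕ → EuclideanSpace ℝ (Fin 3) → EuclideanSpace ℝ (Fin 4)} {S : Set (EuclideanSpace ℝ (Fin 3))}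
    (hS : volume S < ∞) (hdm : ∀ k, AEStronglyMeasurable (d k) (volume.restrict S)) {C : ℝ}
    (hdC : ∀ k, ∀ᵐ x ∂(volume.restrict S), ‖d k x‖ ≤ C)
    (h2 : Tendsto (fun k => ∫ x in S, ‖d k x‖ ^ 2) atTop (𝓝 0)) :
    Tendsto (fun k => ∫ x in S, ‖d k x‖) atTop (𝓝 0) := by
  haveI : IsFiniteMeasure (volume.restrict S) := ⟨by rwa [Measure.restrict_apply_univ]⟩
  set V : ℝ := (volume S).toReal with hV
  have hV0 : 0 ≤ V := ENNReal.toReal_nonneg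
  rw [Metric.tendsto_atTop]
  intro ε hε
  set η : ℝ := ε / (V + 1) with hη
  have hη0 : 0 < η := div_pos hε (by linarith)
  have hηV : η * V < ε := by
    have : η * (V + 1) = ε := by rw [hη]; field_simp
    nlinarith
  obtain ⟨N, hN⟩ := (Metric.tendsto_atTop.1 h2) (η * ε) (mul_pos hη0 hε)
  refine ⟨N, fun k hk => ?_⟩
  have h2k := hN k hk
  have hI0 : 0 ≤ ∫ x in S, ‖d k x‖ := integral_nonneg fun x => norm_nonneg _
  have hI20 : 0 ≤ ∫ x in S, ‖d k x‖ ^ 2 := integral_nonneg fun x => by positivity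
  rw [Real.dist_eq, sub_zero, abs_of_nonneg hI20] at h2k
  rw [Real.dist_eq, sub_zero, abs_of_nonneg hI0]
  -- pointwise bound and integrate
  have hptw : ∀ x, ‖d k x‖ ≤ η / 2 + (2 * η)⁻¹ * ‖d k x‖ ^ 2 := by
    intro x
    have hsq : 0 ≤ (‖d k x‖ - η) ^ 2 := sq_nonneg _
    have h1 : ‖d k x‖ * (2 * η) ≤ η ^ 2 + ‖d k x‖ ^ 2 := by nlinarith
    have h2η : 0 < 2 * η := by linarith
    calc ‖d k x‖ = ‖d k x‖ * (2 * η) * (2 * η)⁻¹ := by field_simp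
      _ ≤ (η ^ 2 + ‖d k x‖ ^ 2) * (2 * η)⁻¹ := by gcongr
      _ = η / 2 + (2 * η)⁻¹ * ‖d k x‖ ^ 2 := by field_simp
  have hint1 : Integrable (fun x => ‖d k x‖) (volume.restrict S) :=
    (integrable_of_norm_le (hdm k) C (hdC k)).norm
  have hint2 : Integrable (fun x => ‖d k x‖ ^ 2) (volume.restrict S) := by
    refine integrable_of_norm_le ((hdm k).norm.pow 2) (C ^ 2) ?_
    filter_upwards [hdC k] with x hx
    rw [Real.norm_eq_abs, abs_of_nonneg (by positivity)]
    exact pow_le_pow_left₀ (norm_nonneg _) hx 2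
  have hle : ∫ x in S, ‖d k x‖ ≤ ∫ x in S, (η / 2 + (2 * η)⁻¹ * ‖d k x‖ ^ 2) :=
    integral_mono hint1 ((integrable_const _).add (hint2.const_mul _)) hptw
  rw [integral_add (integrable_const _) (hint2.const_mul _), integral_const_mul, setIntegral_const] at hle
  have hreal : (volume.real S) = V := by rw [hV, measureReal_def]
  rw [hreal, smul_eq_mul] at hle
  have h3 : (2 * η)⁻¹ * ∫ x in S, ‖d k x‖ ^ 2 ≤ (2 * η)⁻¹ * (η * ε) :=
    mul_le_mul_of_nonneg_left h2k.le (by positivity)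
  have h4 : (2 * η)⁻¹ * (η * ε) = ε / 2 := by field_simp
  nlinarith [hle, h3, h4, hηV, hη0, hV0]


/-! ## §2 The bundled gradient `v ↦ Σ_μ v_μ • G_μ x` -/

/-- The bundled weak gradient: the continuous linear map `v ↦ Σ_μ v_μ • G_μ x` evaluated at a basis vector returns `G_i x` — so S1″'s density letter
`Σ_i ‖G x (single i 1)‖²` is `Σ_i ‖G_i x‖²`. [folklore] -/
theorem sum_smulRight_apply_single (G : Fin 3 → EuclideanSpace ℝ (Fin 3) → EuclideanSpace ℝ (Fin 4))
    (x : EuclideanSpace ℝ (Fin 3)) (i : Fin 3) :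
    (∑ μ : Fin 3, (EuclideanSpace.proj μ).smulRight (G μ x)) (EuclideanSpace.single i (1:ℝ)) = G i x := by
  simp [ContinuousLinearMap.smulRight_apply]

/-- The bundled weak gradient applied to a general vector: `(Σ_μ proj_μ.smulRight (G_μ x)) v = Σ_μ v_μ • G_μ x`. [folklore] -/
theorem sum_smulRight_apply (G : Fin 3 → EuclideanSpace ℝ (Fin 3) → EuclideanSpace ℝ (Fin 4))
    (x v : EuclideanSpace ℝ (Fin 3)) :
    (∑ μ : Fin 3, (EuclideanSpace.proj μ).smulRight (G μ x)) v = ∑ μ : Fin 3, v μ • G μ x := by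
  simp [ContinuousLinearMap.smulRight_apply]

end Summit.QuantumFields.YangMills.Theorems.PoincareLipschitzBlowDownWeakGradientLetters

end
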